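import Summits.KontsevichZagierPeriods.KontsevichZagierPeriods.Theorems.RootDecompQuadraticDescentEisensteinPairP2

/-!
# Census pair #22 (the ℚ(√−3) pair 4·[□²,1/(3−2N)] ≡ 5·[□²,1/(3−N)], N = u²−uv+v²) and #0 DECIDED in `KZ.relations` by rules 1+2 (route `RootDecompQuadraticDescent`, instances of crux stmt-KontsevichZagierPeriods-28994 / stmt-4280) · part 3/7

Cell `decomp-kz`, lens 6 (decomp-kz-lens-6 g7): `pair22 : 4•[□²,1/(1+2x+2y−2x²+2xy−2y²)] − 5•[□²,1/(2+x+y−x²+xy−y²)] ∈ KZ.relations` (values (5/8)·L(2,χ₋₃), L(2,χ₋₃)/2): reflections → diagonal cut + fold → BLOW-UP (u,k) ↦ (u,uk) via `KZ.of_sub_of_mem_relations_of_affine` → fibre substitution into a LOG BAND over q(u) = 1−u+u² → 23 band relations incl. SEVEN ℚ-rational base substitutions (dihedral symmetries + angle doublings of the Eisenstein conic) + one ℤ-identity; NO Stokes; `pair0` by ONE Möbius substitution y = x/(2−x); packaged `pairs_decided`, `pairs_descentTwoQ_instances`, `pairs_of_kzDimTwo` BY NAME.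

Source: `HOME/decomp-kz-lens-6/g7/EisensteinPair22.lean` sha256 fdb5e0bbc5a4a341 (1894 l; critic decomp-kz-crit-1 g2 CLEARED 2026-08-30T07:59:44Z, std axioms), split into 7 modules by the landing seat decomp-kz-census-1 g7 (contexts re-opened per part; generic docstrings added where the source had none; the route file is imported only by the last part, which proves the `KZDimTwo` corollaries BY NAME).  No `sorry`; standard axioms.  References: [cite: KontsevichZagier2001, §1.2].
-/

noncomputable section

open MeasureTheory Set MvPolynomial

namespace Summit.KontsevichZagierPeriods.RootDecompQuadraticDescent.EisensteinPair

open Literature.NumberTheory.Transcendental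
open Literature.NumberTheory.Transcendental.KZ
open Literature.ModelTheory.ExponentialFields (IsSemialgebraic)

-- PRIVATE copy (twin landed in …SurdPairsP2; dedup.landed): injOn_image_of_deriv_pos, injOn_image_of_deriv_neg
/-- Injectivity and image of an interval under a map with positive derivative. -/
private theorem injOn_image_of_deriv_pos {κ κd : ℝ → ℝ} {a b : ℝ} (hab : a ≤ b)
    (hκd : ∀ t ∈ Icc a b, HasDerivAt κ (κd t) t) (hpos : ∀ t ∈ Icc a b, 0 < κd t) :
    InjOn κ (Icc a b) ∧ κ '' Icc a b = Icc (κ a) (κ b) := by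
  have hc : ContinuousOn κ (Icc a b) := fun t ht => (hκd t ht).continuousAt.continuousWithinAt
  have hm : StrictMonoOn κ (Icc a b) := strictMonoOn_of_deriv_pos (convex_Icc a b) hc fun t ht => by
    rw [interior_Icc] at ht
    rw [(hκd t (Ioo_subset_Icc_self ht)).deriv]
    exact hpos t (Ioo_subset_Icc_self ht)
  refine ⟨hm.injOn, Subset.antisymm ?_ (intermediate_value_Icc hab hc)⟩
  rintro _ ⟨t, ht, rfl⟩
  exact ⟨hm.monotoneOn (left_mem_Icc.2 hab) ht ht.1, hm.monotoneOn ht (right_mem_Icc.2 hab) ht.2⟩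

/-- Injectivity and image of an interval under a map with negative derivative. -/
private theorem injOn_image_of_deriv_neg {κ κd : ℝ → ℝ} {a b : ℝ} (hab : a ≤ b)
    (hκd : ∀ t ∈ Icc a b, HasDerivAt κ (κd t) t) (hneg : ∀ t ∈ Icc a b, κd t < 0) :
    InjOn κ (Icc a b) ∧ κ '' Icc a b = Icc (κ b) (κ a) := by
  have hc : ContinuousOn κ (Icc a b) := fun t ht => (hκd t ht).continuousAt.continuousWithinAt
  have hm : StrictAntiOn κ (Icc a b) := strictAntiOn_of_deriv_neg (convex_Icc a b) hc fun t ht => by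
    rw [interior_Icc] at ht
    rw [(hκd t (Ioo_subset_Icc_self ht)).deriv]
    exact hneg t (Ioo_subset_Icc_self ht)
  refine ⟨hm.injOn, Subset.antisymm ?_ (intermediate_value_Icc' hab hc)⟩
  rintro _ ⟨t, ht, rfl⟩
  exact ⟨hm.antitoneOn ht (right_mem_Icc.2 hab) ht.2, hm.antitoneOn (left_mem_Icc.2 hab) ht ht.1⟩

-- PRIVATE copy (landed twin lives in a farm-unbuilt module; dedup.landed): snoc2_zero, snoc2_one, init2_zero
/-- `snoc2_zero`: auxiliary theorem of the lens-6 development «eis» (instances of 28994/4280) — see the module docstring; verbatim from the lens file. -/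
@[simp] private theorem snoc2_zero (x : Fin 1 → ℝ) (t : ℝ) : (Fin.snoc x t : Fin 2 → ℝ) 0 = x 0 := rfl

/-- `snoc2_one`: auxiliary theorem of the lens-6 development «eis» (instances of 28994/4280) — see the module docstring; verbatim from the lens file. -/
@[simp] private theorem snoc2_one (x : Fin 1 → ℝ) (t : ℝ) : (Fin.snoc x t : Fin 2 → ℝ) 1 = t := rfl

/-- `init2_zero`: auxiliary theorem of the lens-6 development «eis» (instances of 28994/4280) — see the module docstring; verbatim from the lens file. -/
@[simp] private theorem init2_zero (z : Fin 2 → ℝ) : Fin.init z 0 = z 0 := rfl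

section Subst

variable (c : ℚ)

/-- Shift `θ ↦ θ − 30°` (`t ↦ (2t−1)/(t+1)`): `U_c([0,1], 3/q) ≡ U_c([−1,½], (2−t)²/q)`. -/
def κS (t : ℝ) : ℝ := (2 * t - 1) / (t + 1)
/-- `κSd`: auxiliary def of the lens-6 development «eis» (instances of 28994/4280) — see the module docstring; verbatim from the lens file. -/
def κSd (t : ℝ) : ℝ := 3 / (t + 1) ^ 2

/-- `two_sub_κS`: auxiliary theorem of the lens-6 development «eis» (instances of 28994/4280) — see the module docstring; verbatim from the lens file. -/
private theorem two_sub_κS {t : ℝ} (h : t + 1 ≠ 0) : 2 - κS t = 3 / (t + 1) := by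
  unfold κS; field_simp; ring
/-- `qf_κS`: auxiliary theorem of the lens-6 development «eis» (instances of 28994/4280) — see the module docstring; verbatim from the lens file. -/
private theorem qf_κS {t : ℝ} (h : t + 1 ≠ 0) : qf (κS t) = 3 * qf t / (t + 1) ^ 2 := by
  unfold κS qf; field_simp; ring
/-- `hasDerivAt_κS`: auxiliary theorem of the lens-6 development «eis» (instances of 28994/4280) — see the module docstring; verbatim from the lens file. -/
private theorem hasDerivAt_κS {t : ℝ} (h : t + 1 ≠ 0) : HasDerivAt κS (κSd t) t := by
  have h1 : HasDerivAt (fun t : ℝ => 2 * t - 1) 2 t := by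
    simpa using ((hasDerivAt_id' t).const_mul 2).sub_const 1
  have h2 : HasDerivAt (fun t : ℝ => t + 1) 1 t := (hasDerivAt_id' t).add_const 1
  exact (h1.div h2 h).congr_deriv (by unfold κSd; field_simp; ring)

/-- `subst_S`: auxiliary theorem of the lens-6 development «eis» (instances of 28994/4280) — see the module docstring; verbatim from the lens file. -/
theorem subst_S : KZ.of (U 0 1 c tq01) - KZ.of (U (-1) (1/2) c ccm1h) ∈ KZ.relations := by
  have hD : ∀ t ∈ Icc ((0 : ℚ) : ℝ) ((1 : ℚ) : ℝ), (0 : ℝ) < t + 1 := fun t ht => by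
    obtain ⟨h1, h2⟩ := ht; norm_num at h1 h2; linarith
  have hd : ∀ t ∈ Icc ((0 : ℚ) : ℝ) ((1 : ℚ) : ℝ), HasDerivAt κS (κSd t) t := fun t ht =>
    hasDerivAt_κS (hD t ht).ne'
  obtain ⟨hinj, himg⟩ := injOn_image_of_deriv_pos (by norm_num) hd
    (fun t ht => by unfold κSd; have := hD t ht; positivity)
  refine rel_subst _ _ κS κSd (2 * X 0 - 1) (X 0 + 1)
    (fun y hy => by have := hD (y 0) hy; simp only [map_add, map_one, aeval_X]; linarith)
    (fun y _ => by simp [κS]) hd hinj (by rw [himg]; norm_num [κS]) (fun t ht => ?_) (fun t ht => ?_)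
  · show tqF t = ccF (κS t)
    have h := (hD t ht).ne'
    have hq := (qf_pos t).ne'
    rw [ccF, two_sub_κS h, qf_κS h, tqF]
    field_simp
    try ring
  · show (c : ℝ) / qf t = c / qf (κS t) * |κSd t|
    have h0 := hD t ht
    have hq := (qf_pos t).ne'
    rw [abs_of_pos (by unfold κSd; positivity), qf_κS h0.ne', κSd]
    field_simp

/-- Evenness `θ ↦ −θ` (`t ↦ −t/(1−t)`): `U_c([−1,0], (2−t)²/q) ≡ U_c([0,½], (2−t)²/q)`. -/
def κE (t : ℝ) : ℝ := -t / (1 - t)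
/-- `κEd`: auxiliary def of the lens-6 development «eis» (instances of 28994/4280) — see the module docstring; verbatim from the lens file. -/
def κEd (t : ℝ) : ℝ := -1 / (1 - t) ^ 2

/-- `two_sub_κE`: auxiliary theorem of the lens-6 development «eis» (instances of 28994/4280) — see the module docstring; verbatim from the lens file. -/
private theorem two_sub_κE {t : ℝ} (h : 1 - t ≠ 0) : 2 - κE t = (2 - t) / (1 - t) := by
  unfold κE; field_simp; ring
/-- `qf_κE`: auxiliary theorem of the lens-6 development «eis» (instances of 28994/4280) — see the module docstring; verbatim from the lens file. -/
private theorem qf_κE {t : ℝ} (h : 1 - t ≠ 0) : qf (κE t) = qf t / (1 - t) ^ 2 := by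
  unfold κE qf; field_simp; ring
/-- `hasDerivAt_κE`: auxiliary theorem of the lens-6 development «eis» (instances of 28994/4280) — see the module docstring; verbatim from the lens file. -/
private theorem hasDerivAt_κE {t : ℝ} (h : 1 - t ≠ 0) : HasDerivAt κE (κEd t) t := by
  have h1 : HasDerivAt (fun t : ℝ => -t) (-1) t := by simpa using (hasDerivAt_id' t).const_mul (-1)
  have h2 : HasDerivAt (fun t : ℝ => 1 - t) (-1) t := by simpa using (hasDerivAt_id' t).const_sub 1
  exact (h1.div h2 h).congr_deriv (by unfold κEd; field_simp; ring)

/-- `subst_E`: auxiliary theorem of the lens-6 development «eis» (instances of 28994/4280) — see the module docstring; verbatim from the lens file. -/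
theorem subst_E : KZ.of (U (-1) 0 c ccm10) - KZ.of (U 0 (1/2) c cc0h) ∈ KZ.relations := by
  have hD : ∀ t ∈ Icc (((-1 : ℚ)) : ℝ) ((0 : ℚ) : ℝ), (0 : ℝ) < 1 - t := fun t ht => by
    obtain ⟨h1, h2⟩ := ht; norm_num at h1 h2; linarith
  have hd : ∀ t ∈ Icc (((-1 : ℚ)) : ℝ) ((0 : ℚ) : ℝ), HasDerivAt κE (κEd t) t := fun t ht =>
    hasDerivAt_κE (hD t ht).ne'
  have hneg : ∀ t ∈ Icc (((-1 : ℚ)) : ℝ) ((0 : ℚ) : ℝ), κEd t < 0 := fun t ht => by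
    unfold κEd; have := hD t ht
    exact div_neg_of_neg_of_pos (by norm_num) (by positivity)
  obtain ⟨hinj, himg⟩ := injOn_image_of_deriv_neg (by norm_num) hd hneg
  refine rel_subst _ _ κE κEd (- X 0) (1 - X 0)
    (fun y hy => by have := hD (y 0) hy; simp only [map_sub, map_one, aeval_X]; linarith)
    (fun y _ => by simp [κE]) hd hinj (by rw [himg]; norm_num [κE]) (fun t ht => ?_) (fun t ht => ?_)
  · show ccF t = ccF (κE t)
    have h := (hD t ht).ne'
    have hq := (qf_pos t).ne'
    rw [ccF, ccF, two_sub_κE h, qf_κE h]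
    field_simp
  · show (c : ℝ) / qf t = c / qf (κE t) * |κEd t|
    have h0 := hD t ht
    have hq := (qf_pos t).ne'
    rw [abs_of_neg (hneg t ht), qf_κE h0.ne', κEd]
    field_simp
    try ring

/-- Complement `θ ↦ 90° − θ` (`t ↦ (2−t)/(1+t)`): `U_c([½,1], 3t²/q) ≡ U_c([½,1], (2−t)²/q)`. -/
def κC (t : ℝ) : ℝ := (2 - t) / (1 + t)
/-- `κCd`: auxiliary def of the lens-6 development «eis» (instances of 28994/4280) — see the module docstring; verbatim from the lens file. -/
def κCd (t : ℝ) : ℝ := -3 / (1 + t) ^ 2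

/-- `two_sub_κC`: auxiliary theorem of the lens-6 development «eis» (instances of 28994/4280) — see the module docstring; verbatim from the lens file. -/
private theorem two_sub_κC {t : ℝ} (h : 1 + t ≠ 0) : 2 - κC t = 3 * t / (1 + t) := by
  unfold κC; field_simp; ring
/-- `qf_κC`: auxiliary theorem of the lens-6 development «eis» (instances of 28994/4280) — see the module docstring; verbatim from the lens file. -/
private theorem qf_κC {t : ℝ} (h : 1 + t ≠ 0) : qf (κC t) = 3 * qf t / (1 + t) ^ 2 := by
  unfold κC qf; field_simp; ring
/-- `hasDerivAt_κC`: auxiliary theorem of the lens-6 development «eis» (instances of 28994/4280) — see the module docstring; verbatim from the lens file. -/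
private theorem hasDerivAt_κC {t : ℝ} (h : 1 + t ≠ 0) : HasDerivAt κC (κCd t) t := by
  have h1 : HasDerivAt (fun t : ℝ => 2 - t) (-1) t := by simpa using (hasDerivAt_id' t).const_sub 2
  have h2 : HasDerivAt (fun t : ℝ => 1 + t) 1 t := by simpa using (hasDerivAt_id' t).const_add 1
  exact (h1.div h2 h).congr_deriv (by unfold κCd; field_simp; ring)

/-- `subst_C`: auxiliary theorem of the lens-6 development «eis» (instances of 28994/4280) — see the module docstring; verbatim from the lens file. -/
theorem subst_C : KZ.of (U (1/2) 1 c ssh1) - KZ.of (U (1/2) 1 c cch1) ∈ KZ.relations := by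
  have hD : ∀ t ∈ Icc (((1/2 : ℚ)) : ℝ) ((1 : ℚ) : ℝ), (0 : ℝ) < 1 + t := fun t ht => by
    obtain ⟨h1, h2⟩ := ht; norm_num at h1 h2; linarith
  have ht0 : ∀ t ∈ Icc (((1/2 : ℚ)) : ℝ) ((1 : ℚ) : ℝ), (0 : ℝ) < t := fun t ht => by
    obtain ⟨h1, h2⟩ := ht; norm_num at h1 h2; linarith
  have hd : ∀ t ∈ Icc (((1/2 : ℚ)) : ℝ) ((1 : ℚ) : ℝ), HasDerivAt κC (κCd t) t := fun t ht =>
    hasDerivAt_κC (hD t ht).ne'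
  have hneg : ∀ t ∈ Icc (((1/2 : ℚ)) : ℝ) ((1 : ℚ) : ℝ), κCd t < 0 := fun t ht => by
    unfold κCd; have := hD t ht
    exact div_neg_of_neg_of_pos (by norm_num) (by positivity)
  obtain ⟨hinj, himg⟩ := injOn_image_of_deriv_neg (by norm_num) hd hneg
  refine rel_subst _ _ κC κCd (2 - X 0) (1 + X 0)
    (fun y hy => by have := hD (y 0) hy; simp only [map_add, map_one, aeval_X]; linarith)
    (fun y _ => by simp [κC]) hd hinj (by rw [himg]; norm_num [κC]) (fun t ht => ?_) (fun t ht => ?_)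
  · show ssF t = ccF (κC t)
    have h := (hD t ht).ne'
    have hq := (qf_pos t).ne'
    rw [ccF, two_sub_κC h, qf_κC h, ssF]
    field_simp
    try ring
  · show (c : ℝ) / qf t = c / qf (κC t) * |κCd t|
    have h0 := hD t ht
    have hq := (qf_pos t).ne'
    rw [abs_of_neg (hneg t ht), qf_κC h0.ne', κCd]
    field_simp
    try ring

/-- Reflection `t ↦ 1 − t` on `[0,1]`: `U_c([0,1], (1+t)²/q) ≡ U_c([0,1], (2−t)²/q)`. -/
theorem subst_R5 : KZ.of (U 0 1 c cp01) - KZ.of (U 0 1 c cc01) ∈ KZ.relations := by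
  have hd : ∀ t ∈ Icc ((0 : ℚ) : ℝ) ((1 : ℚ) : ℝ), HasDerivAt (fun t : ℝ => 1 - t) (-1 : ℝ) t :=
    fun t _ => by simpa using (hasDerivAt_id' t).const_sub 1
  obtain ⟨hinj, himg⟩ := injOn_image_of_deriv_neg (κd := fun _ => (-1 : ℝ)) (by norm_num) hd
    (fun _ _ => by norm_num)
  refine rel_subst _ _ (fun t => 1 - t) (fun _ => -1) (1 - X 0) 1 (fun y _ => by simp)
    (fun y _ => by simp) hd hinj (by rw [himg]; norm_num) (fun t ht => ?_) (fun t ht => ?_)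
  · show cpF t = ccF (1 - t)
    unfold cpF ccF qf; ring
  · simp only [abs_neg, abs_one, mul_one]
    unfold qf; ring

/-- Angle doubling `θ ↦ 2θ − 60°` (`t ↦ (2t−1)/(t(2−t))`):
`U_c([½,1], w²) ≡ U_{c/2}([0,1], (2−t)²/q)`. -/
def κA (t : ℝ) : ℝ := (2 * t - 1) / (t * (2 - t))
/-- `κAd`: auxiliary def of the lens-6 development «eis» (instances of 28994/4280) — see the module docstring; verbatim from the lens file. -/
def κAd (t : ℝ) : ℝ := 2 * qf t / (t * (2 - t)) ^ 2

/-- `two_sub_κA`: auxiliary theorem of the lens-6 development «eis» (instances of 28994/4280) — see the module docstring; verbatim from the lens file. -/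
private theorem two_sub_κA {t : ℝ} (h : t * (2 - t) ≠ 0) : 2 - κA t = (1 + 2 * t - 2 * t ^ 2) / (t * (2 - t)) := by
  unfold κA
  generalize hD : t * (2 - t) = D at h ⊢
  field_simp
  subst hD; ring
/-- `qf_κA`: auxiliary theorem of the lens-6 development «eis» (instances of 28994/4280) — see the module docstring; verbatim from the lens file. -/
private theorem qf_κA {t : ℝ} (h : t * (2 - t) ≠ 0) : qf (κA t) = qf t ^ 2 / (t * (2 - t)) ^ 2 := by
  unfold κA qf
  generalize hD : t * (2 - t) = D at h ⊢
  field_simp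
  subst hD; ring
/-- `hasDerivAt_κA`: auxiliary theorem of the lens-6 development «eis» (instances of 28994/4280) — see the module docstring; verbatim from the lens file. -/
theorem hasDerivAt_κA {t : ℝ} (h : t * (2 - t) ≠ 0) : HasDerivAt κA (κAd t) t := by
  have h1 : HasDerivAt (fun t : ℝ => 2 * t - 1) 2 t := by
    simpa using ((hasDerivAt_id' t).const_mul 2).sub_const 1
  have h2 : HasDerivAt (fun t : ℝ => t * (2 - t)) (1 * (2 - t) + t * (-1)) t :=
    (hasDerivAt_id' t).mul ((hasDerivAt_id' t).const_sub 2)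
  refine (h1.div h2 h).congr_deriv ?_
  unfold κAd qf
  generalize hD : t * (2 - t) = D at h ⊢
  field_simp
  subst hD; ring

/-- `subst_A`: auxiliary theorem of the lens-6 development «eis» (instances of 28994/4280) — see the module docstring; verbatim from the lens file. -/
theorem subst_A : KZ.of (U (1/2) 1 c wsqh1) - KZ.of (U 0 1 (c/2) cc01) ∈ KZ.relations := by
  have hD : ∀ t ∈ Icc (((1/2 : ℚ)) : ℝ) ((1 : ℚ) : ℝ), (0 : ℝ) < t * (2 - t) := fun t ht => by
    obtain ⟨h1, h2⟩ := ht; norm_num at h1 h2; nlinarith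
  have hd : ∀ t ∈ Icc (((1/2 : ℚ)) : ℝ) ((1 : ℚ) : ℝ), HasDerivAt κA (κAd t) t := fun t ht =>
    hasDerivAt_κA (hD t ht).ne'
  obtain ⟨hinj, himg⟩ := injOn_image_of_deriv_pos (by norm_num) hd
    (fun t ht => by unfold κAd; have := hD t ht; have := qf_pos t; positivity)
  refine rel_subst _ _ κA κAd (2 * X 0 - 1) (X 0 * (2 - X 0))
    (fun y hy => by
      have := hD (y 0) hy; simp only [map_sub, map_mul, map_ofNat, aeval_X]; exact this.ne')
    (fun y _ => by simp [κA]) hd hinj (by rw [himg]; norm_num [κA]) (fun t ht => ?_) (fun t ht => ?_)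
  · show (1 + 2 * t - 2 * t ^ 2) ^ 2 / qf t ^ 2 = ccF (κA t)
    have h := (hD t ht).ne'
    have hq := (qf_pos t).ne'
    rw [ccF, two_sub_κA h, qf_κA h]
    generalize t * (2 - t) = D at h ⊢
    generalize qf t = Q at hq ⊢
    field_simp
  · show (c : ℝ) / qf t = (c / 2 : ℚ) / qf (κA t) * |κAd t|
    have h0 := hD t ht
    have hq := (qf_pos t).ne'
    rw [abs_of_pos (by unfold κAd; have := qf_pos t; positivity), qf_κA h0.ne', κAd]
    push_cast
    have h := h0.ne'
    generalize t * (2 - t) = D at h ⊢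
    generalize qf t = Q at hq ⊢
    field_simp
    try ring

/-- Angle doubling `θ ↦ 2θ − 90°` (`t ↦ (t²+2t−2)/(4t−1−t²)`):
`U_c([½,1], (2 sin 2θ)²) ≡ U_{c/2}([−1,½], (2−t)²/q)`. -/
def κD (t : ℝ) : ℝ := (t ^ 2 + 2 * t - 2) / (4 * t - 1 - t ^ 2)
/-- `κDd`: auxiliary def of the lens-6 development «eis» (instances of 28994/4280) — see the module docstring; verbatim from the lens file. -/
def κDd (t : ℝ) : ℝ := 6 * qf t / (4 * t - 1 - t ^ 2) ^ 2

/-- `two_sub_κD`: auxiliary theorem of the lens-6 development «eis» (instances of 28994/4280) — see the module docstring; verbatim from the lens file. -/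
private theorem two_sub_κD {t : ℝ} (h : 4 * t - 1 - t ^ 2 ≠ 0) :
    2 - κD t = 3 * t * (2 - t) / (4 * t - 1 - t ^ 2) := by
  unfold κD
  generalize hD : 4 * t - 1 - t ^ 2 = D at h ⊢
  field_simp
  subst hD; ring
/-- `qf_κD`: auxiliary theorem of the lens-6 development «eis» (instances of 28994/4280) — see the module docstring; verbatim from the lens file. -/
private theorem qf_κD {t : ℝ} (h : 4 * t - 1 - t ^ 2 ≠ 0) : qf (κD t) = 3 * qf t ^ 2 / (4 * t - 1 - t ^ 2) ^ 2 := by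
  unfold κD qf
  generalize hD : 4 * t - 1 - t ^ 2 = D at h ⊢
  field_simp
  subst hD; ring
/-- `hasDerivAt_κD`: auxiliary theorem of the lens-6 development «eis» (instances of 28994/4280) — see the module docstring; verbatim from the lens file. -/
theorem hasDerivAt_κD {t : ℝ} (h : 4 * t - 1 - t ^ 2 ≠ 0) : HasDerivAt κD (κDd t) t := by
  have h1 : HasDerivAt (fun t : ℝ => t ^ 2 + 2 * t - 2) (2 * 1 * t + 2) t :=
    (hasDerivAt_quad 1 2 (-2) t).congr_of_eventuallyEq (Filter.Eventually.of_forall fun y => by ring)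
  have h2 : HasDerivAt (fun t : ℝ => 4 * t - 1 - t ^ 2) (2 * (-1) * t + 4) t :=
    (hasDerivAt_quad (-1) 4 (-1) t).congr_of_eventuallyEq (Filter.Eventually.of_forall fun y => by ring)
  refine (h1.div h2 h).congr_deriv ?_
  unfold κDd qf
  generalize hD : 4 * t - 1 - t ^ 2 = D at h ⊢
  field_simp
  subst hD; ring

/-- `subst_D`: auxiliary theorem of the lens-6 development «eis» (instances of 28994/4280) — see the module docstring; verbatim from the lens file. -/
theorem subst_D : KZ.of (U (1/2) 1 c sscch1) - KZ.of (U (-1) (1/2) (c/2) ccm1h) ∈ KZ.relations := by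
  have hD : ∀ t ∈ Icc (((1/2 : ℚ)) : ℝ) ((1 : ℚ) : ℝ), (0 : ℝ) < 4 * t - 1 - t ^ 2 :=
    fun t ht => by obtain ⟨h1, h2⟩ := ht; norm_num at h1 h2; nlinarith
  have hd : ∀ t ∈ Icc (((1/2 : ℚ)) : ℝ) ((1 : ℚ) : ℝ), HasDerivAt κD (κDd t) t := fun t ht =>
    hasDerivAt_κD (hD t ht).ne'
  obtain ⟨hinj, himg⟩ := injOn_image_of_deriv_pos (by norm_num) hd
    (fun t ht => by unfold κDd; have := hD t ht; have := qf_pos t; positivity)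
  refine rel_subst _ _ κD κDd (X 0 ^ 2 + 2 * X 0 - 2) (4 * X 0 - 1 - X 0 ^ 2)
    (fun y hy => by
      have := hD (y 0) hy; simp only [map_sub, map_mul, map_pow, map_ofNat, map_one, aeval_X]
      exact this.ne')
    (fun y _ => by simp [κD]) hd hinj (by rw [himg]; norm_num [κD]) (fun t ht => ?_) (fun t ht => ?_)
  · show 3 * t ^ 2 * (2 - t) ^ 2 / (qf t * qf t) = ccF (κD t)
    have h := (hD t ht).ne'
    have hq := (qf_pos t).ne'
    rw [ccF, two_sub_κD h, qf_κD h]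
    generalize 4 * t - 1 - t ^ 2 = D at h ⊢
    generalize qf t = Q at hq ⊢
    field_simp
    try ring
  · show (c : ℝ) / qf t = (c / 2 : ℚ) / qf (κD t) * |κDd t|
    have h0 := hD t ht
    have hq := (qf_pos t).ne'
    rw [abs_of_pos (by unfold κDd; have := qf_pos t; positivity), qf_κD h0.ne', κDd]
    push_cast
    have h := h0.ne'
    generalize 4 * t - 1 - t ^ 2 = D at h ⊢
    generalize qf t = Q at hq ⊢
    field_simp
    try ring

end Subst

/-! ## Part II: the one-dimensional core `2·U(v_A) ≡ 5·U(v_B)`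

Twenty-three elementary relations between band representations (product rule, halving, cuts and
the seven substitutions) and one integer identity between them. -/

section Core
variable (c : ℚ)

/-- `tq_eq_vA_mul_w`: auxiliary theorem of the lens-6 development «eis» (instances of 28994/4280) — see the module docstring; verbatim from the lens file. -/
theorem tq_eq_vA_mul_w {t : ℝ} (ht : t ∈ Icc ((0 : ℚ) : ℝ) ((1 : ℚ) : ℝ)) : tqF t = vAF t * wF t := by
  obtain ⟨h1, h2⟩ := ht; norm_num at h1 h2
  have hd := (dA_pos h1 h2).ne'
  have hq := (qf_pos t).ne'
  unfold tqF vAF wF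
  rw [div_mul_div_comm, div_eq_div_iff hq (mul_ne_zero hd hq)]
  ring

/-- `tq_eq_vB_mul_wB`: auxiliary theorem of the lens-6 development «eis» (instances of 28994/4280) — see the module docstring; verbatim from the lens file. -/
theorem tq_eq_vB_mul_wB {t : ℝ} (ht : t ∈ Icc ((0 : ℚ) : ℝ) ((1 : ℚ) : ℝ)) : tqF t = vBF t * wBF t := by
  obtain ⟨h1, h2⟩ := ht; norm_num at h1 h2
  have hd := (dB_pos h1 h2).ne'
  have hq := (qf_pos t).ne'
  unfold tqF vBF wBF
  rw [div_mul_div_comm, div_eq_div_iff hq (mul_ne_zero hd hq)]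
  ring

end Core

end Summit.KontsevichZagierPeriods.RootDecompQuadraticDescent.EisensteinPair

end
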